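import Literature.Geometry.Lorentzian.LeviCivitaProofs
import HarnessLib

/-!
# The covariant differential of a field of bilinear forms (discharge of `covDeriv₂_apply`)

This file discharges the named fact `PseudoRiemannianMetric.covDeriv₂_apply` of
`Literature/Geometry/Lorentzian/LeviCivita.lean` about the covariant derivative
`∇k = g.covDeriv₂ k` of a field `k` of continuous bilinear forms on `TM` (the Levi-Civita
connection `∇ = g.leviCivita` of a `C^n` pseudo-Riemannian metric `g`, `n ≥ 1`, extended to
`(0,2)`-tensors):

* `PseudoRiemannianMetric.covDeriv₂_apply_holds` — for `k` differentiable at `x` (as a section of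
  `Hom(TM, Hom(TM, ℝ))`) and vector fields `X, Y, Z` differentiable at `x`,
  `(∇k)_x(X_x, Y_x, Z_x) = Z(k(X,Y))(x) - k_x(∇_Z X, Y) - k_x(X, ∇_Z Y)`
  (`= covDeriv₂Aux g k X Y Z x`).

(The companion fact `covDeriv₂_val`, `∇g = 0`, is discharged in `LeviCivitaProofs.lean`,
`covDeriv₂_val_holds`, by metric compatibility alone; it needs none of the tensoriality below.)

## The printed argument

O'Neill 1983 defines the covariant derivative `D_V` on all tensor fields as the tensor derivation
extending `V` and the Levi-Civita connection (Ch. 3, Def. 3.16, via Ch. 2, Thm. 2.15), and the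
covariant differential `DA` of an `(0, s)` tensor `A` as the `(0, s+1)` tensor
`(DA)(X₁, …, X_s, V) = (D_V A)(X₁, …, X_s)` (Ch. 3, Def. 3.17 — new slot last, as in `covDeriv₂`).
By the product rule for tensor derivations (Ch. 2, Prop. 2.13), solved for `D_V A` as in the proof
of Thm. 2.15 (p. 48: "`(𝒟A)(X₁,…,X_s) = V(A(X₁,…,X_s)) - ∑ A(X₁,…,δX_j,…,X_s)` … it is easy to
verify that `𝒟A` is `𝔉(M)`-multilinear hence is an `(r, s)` tensor"), for `s = 2`:

  `(DA)(X, Y, V) = V(A(X, Y)) - A(D_V X, Y) - A(X, D_V Y)`,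

which is `covDeriv₂Aux g k X Y V`. That an `𝔉(M)`-multilinear operation has a value at each point,
computed on *any* vector fields extending the given tangent vectors, is O'Neill, Ch. 2, Prop. 2.2
with Lemma 2.3 (pp. 41–42: "`A_p(x₁,…,x_s) = A(X₁,…,X_s)(p)` where `X_i` are any vector fields such
that `X_i|_p = x_i`"); in Mathlib this is the tensoriality criterion `TensorialAt.pointwise` and the
constructions `TensorialAt.mkHom`, `TensorialAt.mkHom₂` on `FiberBundle.extend`ed vectors, which is
literally how `covDeriv₂` is defined in `LeviCivita.lean` (the unique trilinear map agreeing with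
`covDeriv₂Aux` on extended vectors, junk `0` if none exists).

The Lean proof follows this architecture pointwise at `x` (Mathlib's covariant derivatives act on
all sections and are meaningful only at points of differentiability, so "𝔉(M)-multilinear" becomes
`TensorialAt … x` on sections differentiable at `x`):

1. `mdifferentiableAt_bilin_apply`: `y ↦ k_y(A_y, B_y)` is differentiable at `x` when `k`, `A`, `B`
   are (Mathlib's `MDifferentiableAt.clm_bundle_apply₂`);
2. `tensorialAt_covDeriv₂Aux₁/₂/₃`: `covDeriv₂Aux g k X Y Z x` is tensorial in `X` (for `k`, `Y`
   differentiable at `x`), in `Y` (for `k`, `X` differentiable), and in `Z` (always: `Z` enters only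
   through `Z x`) — the "easy verification" of Thm. 2.15: with `h = k(X,Y)`, the product rules
   `Z(fh) = (Zf) h + f (Zh)` (Mathlib's `mvfderiv_mul`) and `∇_Z (fX) = (Zf) X + f ∇_Z X` (the
   Leibniz rule of `g.leviCivita`, Mathlib's `IsCovariantDerivativeOn.leibniz`) produce two terms
   `(Zf) k(X,Y)` that cancel;
3. `covDeriv₂Aux_apply_eq_extend`: hence its value depends on `X`, `Y`, `Z` only through
   `X x, Y x, Z x` (Prop. 2.2; Mathlib's `TensorialAt.pointwise₂`);
4. `exists_covDeriv₂_repr`: the trilinear map `K = mkHom₂ (X, Y ↦ mkHom (Z ↦ covDeriv₂Aux …))`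
   represents `covDeriv₂Aux` on extended vectors, so the defining `dif` of `covDeriv₂` takes its
   first branch (`covDeriv₂_apply_extend`), and (3) converts extended vectors back to the given
   fields (`covDeriv₂_apply_holds`).

Remark on locators: the docstring of `covDeriv₂_apply` in `LeviCivita.lean` cites "Ch. 3,
Prop. 3.18"; in O'Neill 1983 Prop. 3.18 is the induced covariant derivative on curves, and the
formula discharged here is Ch. 2, Prop. 2.13/Thm. 2.15 with Ch. 3, Def. 3.16–3.17 (the statement
itself is unaffected).

## References

* [ONeillSemiRiemannian1983] (= the interim key `ONeill1983` of `LeviCivita.lean`) B. O'Neill,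
  *Semi-Riemannian geometry with applications to relativity*, Academic Press 1983: Ch. 2,
  Prop. 2.2 and Lemma 2.3 (pp. 41–42, tensors are pointwise), Def. 2.11, Prop. 2.13 (product
  rule, p. 47), Thm. 2.15 (p. 48); Ch. 3, Thm. 3.11 (p. 61), Def. 3.16–3.17 (pp. 64–65,
  covariant derivative of tensor fields, covariant differential, parallel tensors).
* J. M. Lee, *Introduction to Riemannian Manifolds*, 2nd ed., Springer GTM 176, 2018, Prop. 4.15
  and Lemma 4.6 (tensor characterization lemma).
-/

noncomputable section

open Bundle Set NormedSpace FiberBundle VectorField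
open scoped Manifold ContDiff Topology

namespace Literature.Geometry.Lorentzian

variable {E : Type*} [NormedAddCommGroup E] [NormedSpace ℝ E] {H : Type*} [TopologicalSpace H]
  {I : ModelWithCorners ℝ E H} {M : Type*} [TopologicalSpace M] [ChartedSpace H M]
  [IsManifold I ∞ M] {n : ℕ∞ω} {x : M}

/-- **A differentiable field of bilinear forms evaluated on differentiable vector fields is
differentiable**: if `k` (a section of `Hom(TM, Hom(TM, ℝ))`), `A` and `B` are differentiable at
`x`, so is the scalar function `y ↦ k_y(A_y, B_y)` (Mathlib's `MDifferentiableAt.clm_bundle_apply₂`;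
the case `k = g` is `PseudoRiemannianMetric.mdifferentiableAt_val_apply`). This is the smoothness
half of O'Neill's identification of tensor fields with `𝔉(M)`-multilinear maps (Ch. 2, p. 42).
[folklore] -/
theorem mdifferentiableAt_bilin_apply
    {k : Π x : M, TangentSpace I x →L[ℝ] TangentSpace I x →L[ℝ] ℝ}
    (hk : MDifferentiableAt I (I.prod 𝓘(ℝ, E →L[ℝ] E →L[ℝ] ℝ))
      (fun y ↦ TotalSpace.mk' (E →L[ℝ] E →L[ℝ] ℝ)
        (E := fun y : M ↦ TangentSpace I y →L[ℝ] TangentSpace I y →L[ℝ] ℝ) y (k y)) x)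
    {A B : Π x : M, TangentSpace I x} (hA : MDiffAt (T% A) x) (hB : MDiffAt (T% B) x) :
    MDiffAt (fun y ↦ k y (A y) (B y)) x := by
  have : MDifferentiableAt I (I.prod 𝓘(ℝ, ℝ))
      (fun y ↦ TotalSpace.mk' ℝ (E := Bundle.Trivial M ℝ) y (k y (A y) (B y))) x := by
    apply MDifferentiableAt.clm_bundle_apply₂ (F₁ := E) (F₂ := E)
    · exact hk
    · exact hA
    · exact hB
  simp only [mdifferentiableAt_totalSpace] at this
  exact this.2

namespace PseudoRiemannianMetric

variable {g : PseudoRiemannianMetric I n E (TangentSpace I : M → Type _)}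
  {k : Π x : M, TangentSpace I x →L[ℝ] TangentSpace I x →L[ℝ] ℝ}

/-! ## Tensoriality of `covDeriv₂Aux` (O'Neill, Thm. 2.15: "`𝒟A` is `𝔉(M)`-multilinear") -/

/-- **`(∇k)(X, Y, Z)` is tensorial in `X`** at `x`, for `k` and `Y` differentiable at `x` (any
`Z`): `(∇_Z k)(fX, Y) = f (∇_Z k)(X, Y)` and additivity. With `h = k(X, Y)`:
`Z(f h) - k(∇_Z (fX), Y) - k(fX, ∇_Z Y)
  = (Zf) h + f Zh - (Zf) k(X,Y) - f k(∇_Z X, Y) - f k(X, ∇_Z Y)`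
by the product rule `mvfderiv_mul` and the Leibniz rule of the Levi-Civita connection
(`IsCovariantDerivativeOn.leibniz`); the two `(Zf)`-terms cancel. O'Neill 1983, Ch. 2, proof of
Thm. 2.15 (p. 48), for the tensor derivation `D_Z` of Ch. 3, Def. 3.16.
[cite: ONeillSemiRiemannian1983, Ch. 2, Thm. 2.15 (proof, p. 48) and Ch. 3, Def. 3.16] -/
theorem tensorialAt_covDeriv₂Aux₁ [g.HasLeviCivita]
    (hk : MDifferentiableAt I (I.prod 𝓘(ℝ, E →L[ℝ] E →L[ℝ] ℝ))
      (fun y ↦ TotalSpace.mk' (E →L[ℝ] E →L[ℝ] ℝ)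
        (E := fun y : M ↦ TangentSpace I y →L[ℝ] TangentSpace I y →L[ℝ] ℝ) y (k y)) x)
    {Y : Π x : M, TangentSpace I x} (hY : MDiffAt (T% Y) x) (Z : Π x : M, TangentSpace I x) :
    TensorialAt I E (fun X ↦ g.covDeriv₂Aux k X Y Z x) x where
  smul {f X} hf hX := by
    have e1 : (fun y ↦ k y ((f • X) y) (Y y)) = f * fun y ↦ k y (X y) (Y y) := by
      funext y; simp [Pi.smul_apply', map_smul, smul_eq_mul]
    have hl : g.leviCivita (f • X) x = f x • g.leviCivita X x + (mvfderiv I f x).smulRight (X x) :=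
      g.leviCivita.isCovariantDerivativeOnUniv.leibniz hX hf
    simp only [covDeriv₂Aux]
    rw [e1, mvfderiv_mul hf (mdifferentiableAt_bilin_apply hk hX hY), hl]
    simp only [add_apply, smul_apply,
      ContinuousLinearMap.smulRight_apply, Pi.smul_apply', map_add, map_smul, smul_eq_mul]
    ring
  add {X X'} hX hX' := by
    have e1 : (fun y ↦ k y ((X + X') y) (Y y)) =
        (fun y ↦ k y (X y) (Y y)) + fun y ↦ k y (X' y) (Y y) := by
      funext y; simp [map_add]
    have hl : g.leviCivita (X + X') x = g.leviCivita X x + g.leviCivita X' x :=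
      g.leviCivita.isCovariantDerivativeOnUniv.add hX hX'
    simp only [covDeriv₂Aux]
    rw [e1, mvfderiv_add (mdifferentiableAt_bilin_apply hk hX hY)
      (mdifferentiableAt_bilin_apply hk hX' hY), hl]
    simp only [add_apply, Pi.add_apply, map_add]
    ring

/-- **`(∇k)(X, Y, Z)` is tensorial in `Y`** at `x`, for `k` and `X` differentiable at `x` (any
`Z`); same cancellation as in `tensorialAt_covDeriv₂Aux₁`. O'Neill 1983, Ch. 2, proof of
Thm. 2.15 (p. 48), for `D_Z` of Ch. 3, Def. 3.16.
[cite: ONeillSemiRiemannian1983, Ch. 2, Thm. 2.15 (proof, p. 48) and Ch. 3, Def. 3.16] -/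
theorem tensorialAt_covDeriv₂Aux₂ [g.HasLeviCivita]
    (hk : MDifferentiableAt I (I.prod 𝓘(ℝ, E →L[ℝ] E →L[ℝ] ℝ))
      (fun y ↦ TotalSpace.mk' (E →L[ℝ] E →L[ℝ] ℝ)
        (E := fun y : M ↦ TangentSpace I y →L[ℝ] TangentSpace I y →L[ℝ] ℝ) y (k y)) x)
    {X : Π x : M, TangentSpace I x} (hX : MDiffAt (T% X) x) (Z : Π x : M, TangentSpace I x) :
    TensorialAt I E (fun Y ↦ g.covDeriv₂Aux k X Y Z x) x where
  smul {f Y} hf hY := by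
    have e1 : (fun y ↦ k y (X y) ((f • Y) y)) = f * fun y ↦ k y (X y) (Y y) := by
      funext y; simp [Pi.smul_apply', map_smul, smul_eq_mul]
    have hl : g.leviCivita (f • Y) x = f x • g.leviCivita Y x + (mvfderiv I f x).smulRight (Y x) :=
      g.leviCivita.isCovariantDerivativeOnUniv.leibniz hY hf
    simp only [covDeriv₂Aux]
    rw [e1, mvfderiv_mul hf (mdifferentiableAt_bilin_apply hk hX hY), hl]
    simp only [add_apply, smul_apply,
      ContinuousLinearMap.smulRight_apply, Pi.smul_apply', map_add, map_smul, smul_eq_mul]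
    ring
  add {Y Y'} hY hY' := by
    have e1 : (fun y ↦ k y (X y) ((Y + Y') y)) =
        (fun y ↦ k y (X y) (Y y)) + fun y ↦ k y (X y) (Y' y) := by
      funext y; simp [map_add]
    have hl : g.leviCivita (Y + Y') x = g.leviCivita Y x + g.leviCivita Y' x :=
      g.leviCivita.isCovariantDerivativeOnUniv.add hY hY'
    simp only [covDeriv₂Aux]
    rw [e1, mvfderiv_add (mdifferentiableAt_bilin_apply hk hX hY)
      (mdifferentiableAt_bilin_apply hk hX hY'), hl]
    simp only [add_apply, Pi.add_apply, map_add]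
    ring

/-- **`(∇k)(X, Y, Z)` is tensorial in the derivative slot `Z`** at `x`, for arbitrary `k`, `X`,
`Y`: `covDeriv₂Aux g k X Y Z x` involves `Z` only through `Z x`, linearly (`𝔉(M)`-linearity of
`V ↦ D_V A`, O'Neill 1983, Ch. 3, remark before Def. 3.17, p. 65, "(D1)").
[cite: ONeillSemiRiemannian1983, Ch. 3, Def. 3.17 (p. 65)] -/
theorem tensorialAt_covDeriv₂Aux₃ [g.HasLeviCivita] (k : Π x : M, TangentSpace I x →L[ℝ]
      TangentSpace I x →L[ℝ] ℝ) (X Y : Π x : M, TangentSpace I x) :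
    TensorialAt I E (fun Z ↦ g.covDeriv₂Aux k X Y Z x) x where
  smul {f Z} _ _ := by
    simp only [covDeriv₂Aux, Pi.smul_apply', map_smul, smul_apply,
      smul_eq_mul]
    ring
  add {Z Z'} _ _ := by
    simp only [covDeriv₂Aux, Pi.add_apply, map_add, add_apply]
    ring

/-! ## Pointwise dependence and representability (O'Neill, Prop. 2.2) -/

/-- **`(∇k)(X, Y, Z)(x)` depends on `X, Y, Z` only through `X_x, Y_x, Z_x`** (for `k`, `X`, `Y`
differentiable at `x`): it may be computed on the extended tangent vectors
`extend E (X x)`, `extend E (Y x)`, `extend E (Z x)`. O'Neill 1983, Ch. 2, Prop. 2.2 (p. 41: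
tensors are pointwise) applied to the tensor `DA` of Thm. 2.15; in Mathlib, `TensorialAt.pointwise₂`
for the slots `X`, `Y` and `FiberBundle.extend_apply_self` for `Z`.
[cite: ONeillSemiRiemannian1983, Ch. 2, Prop. 2.2 (p. 41)] -/
theorem covDeriv₂Aux_apply_eq_extend [g.HasLeviCivita] [FiniteDimensional ℝ E]
    (hk : MDifferentiableAt I (I.prod 𝓘(ℝ, E →L[ℝ] E →L[ℝ] ℝ))
      (fun y ↦ TotalSpace.mk' (E →L[ℝ] E →L[ℝ] ℝ)
        (E := fun y : M ↦ TangentSpace I y →L[ℝ] TangentSpace I y →L[ℝ] ℝ) y (k y)) x)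
    {X Y : Π x : M, TangentSpace I x} (hX : MDiffAt (T% X) x) (hY : MDiffAt (T% Y) x)
    (Z : Π x : M, TangentSpace I x) :
    g.covDeriv₂Aux k X Y Z x =
      g.covDeriv₂Aux k (extend E (X x)) (extend E (Y x)) (extend E (Z x)) x := by
  have hZ : g.covDeriv₂Aux k (extend E (X x)) (extend E (Y x)) (extend E (Z x)) x =
      g.covDeriv₂Aux k (extend E (X x)) (extend E (Y x)) Z x := by
    simp only [covDeriv₂Aux, extend_apply_self]
  rw [hZ]
  exact TensorialAt.pointwise₂ (Φ := fun X Y ↦ g.covDeriv₂Aux k X Y Z x)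
    (fun _ hτ ↦ tensorialAt_covDeriv₂Aux₁ hk hτ Z) (fun _ hσ ↦ tensorialAt_covDeriv₂Aux₂ hk hσ Z)
    hX (mdifferentiableAt_extend ..) hY (mdifferentiableAt_extend ..) (by simp) (by simp)

/-- **Representability of `∇k` at `x`** for `k` differentiable at `x`: there is a continuous
trilinear map `K` on `T_x M` with `K X₀ Y₀ Z₀ = covDeriv₂Aux g k X̃₀ Ỹ₀ Z̃₀ x` for all tangent
vectors (extended to local fields by `FiberBundle.extend`) — O'Neill 1983, Ch. 2, Prop. 2.2 and
the paragraph following its proof (p. 42: "the function `A_p` is `ℝ`-multilinear"), for the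
`𝔉(M)`-multilinear `DA` of Thm. 2.15. Construction: `Z ↦ covDeriv₂Aux g k X Y Z x` is tensorial
(`tensorialAt_covDeriv₂Aux₃`), giving a covector `L X Y` by `TensorialAt.mkHom`; `L` is
tensorial in `X` and in `Y` (`tensorialAt_covDeriv₂Aux₁/₂`), giving `K` by `TensorialAt.mkHom₂`.
[cite: ONeillSemiRiemannian1983, Ch. 2, Prop. 2.2 (p. 42)] -/
theorem exists_covDeriv₂_repr [g.HasLeviCivita] [FiniteDimensional ℝ E]
    (hk : MDifferentiableAt I (I.prod 𝓘(ℝ, E →L[ℝ] E →L[ℝ] ℝ))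
      (fun y ↦ TotalSpace.mk' (E →L[ℝ] E →L[ℝ] ℝ)
        (E := fun y : M ↦ TangentSpace I y →L[ℝ] TangentSpace I y →L[ℝ] ℝ) y (k y)) x) :
    ∃ K : TangentSpace I x →L[ℝ] TangentSpace I x →L[ℝ] TangentSpace I x →L[ℝ] ℝ,
      ∀ X₀ Y₀ Z₀ : TangentSpace I x,
        K X₀ Y₀ Z₀ = g.covDeriv₂Aux k (extend E X₀) (extend E Y₀) (extend E Z₀) x := by
  -- slot `Z`: a covector for every pair of fields `X, Y`
  let L : (Π x : M, TangentSpace I x) → (Π x : M, TangentSpace I x) →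
      (TangentSpace I x →L[ℝ] ℝ) := fun X Y ↦
    TensorialAt.mkHom (fun Z ↦ g.covDeriv₂Aux k X Y Z x) x (tensorialAt_covDeriv₂Aux₃ k X Y)
  have hL : ∀ (X Y : Π x : M, TangentSpace I x) (Z₀ : TangentSpace I x),
      L X Y Z₀ = g.covDeriv₂Aux k X Y (extend E Z₀) x := fun X Y Z₀ ↦ rfl
  -- `L` is tensorial in `X` (for `Y` differentiable) and in `Y` (for `X` differentiable)
  have hL₁ : ∀ Y : Π x : M, TangentSpace I x, MDiffAt (T% Y) x → TensorialAt I E (L · Y) x := by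
    intro Y hY
    refine ⟨fun {f X} hf hX ↦ ?_, fun {X X'} hX hX' ↦ ?_⟩
    · ext Z₀
      rw [hL, smul_apply, hL]
      exact (tensorialAt_covDeriv₂Aux₁ hk hY (extend E Z₀)).smul hf hX
    · ext Z₀
      rw [hL, add_apply, hL, hL]
      exact (tensorialAt_covDeriv₂Aux₁ hk hY (extend E Z₀)).add hX hX'
  have hL₂ : ∀ X : Π x : M, TangentSpace I x, MDiffAt (T% X) x → TensorialAt I E (L X ·) x := by
    intro X hX
    refine ⟨fun {f Y} hf hY ↦ ?_, fun {Y Y'} hY hY' ↦ ?_⟩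
    · ext Z₀
      rw [hL, smul_apply, hL]
      exact (tensorialAt_covDeriv₂Aux₂ hk hX (extend E Z₀)).smul hf hY
    · ext Z₀
      rw [hL, add_apply, hL, hL]
      exact (tensorialAt_covDeriv₂Aux₂ hk hX (extend E Z₀)).add hY hY'
  refine ⟨TensorialAt.mkHom₂ L x hL₁ hL₂, fun X₀ Y₀ Z₀ ↦ ?_⟩
  rw [TensorialAt.mkHom₂_apply_eq_extend, hL]

/-! ## The named fact `covDeriv₂_apply` -/

/-- **`∇k` on extended vectors.** For `k` differentiable at `x`, the trilinear map `g.covDeriv₂ k x`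
agrees with `covDeriv₂Aux g k` on extended tangent vectors: its defining `dif` takes the first
branch by `exists_covDeriv₂_repr`. O'Neill 1983, Ch. 2, Prop. 2.2 and Thm. 2.15; Ch. 3, Def. 3.17.
[cite: ONeillSemiRiemannian1983, Ch. 3, Def. 3.17 (p. 65)] -/
theorem covDeriv₂_apply_extend [g.HasLeviCivita] [FiniteDimensional ℝ E]
    (hk : MDifferentiableAt I (I.prod 𝓘(ℝ, E →L[ℝ] E →L[ℝ] ℝ))
      (fun y ↦ TotalSpace.mk' (E →L[ℝ] E →L[ℝ] ℝ)
        (E := fun y : M ↦ TangentSpace I y →L[ℝ] TangentSpace I y →L[ℝ] ℝ) y (k y)) x)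
    (X₀ Y₀ Z₀ : TangentSpace I x) :
    g.covDeriv₂ k x X₀ Y₀ Z₀ = g.covDeriv₂Aux k (extend E X₀) (extend E Y₀) (extend E Z₀) x := by
  have hex := exists_covDeriv₂_repr (g := g) hk
  simp only [covDeriv₂, dif_pos hex]
  exact hex.choose_spec X₀ Y₀ Z₀

/-- **The covariant differential of a field of bilinear forms** (discharge of the named fact
`covDeriv₂_apply` of `LeviCivita.lean`): for `k` differentiable at `x` and vector fields `X, Y, Z`
differentiable at `x`,
`(∇k)_x(X_x, Y_x, Z_x) = Z(k(X,Y))(x) - k_x(∇_Z X, Y) - k_x(X, ∇_Z Y)`.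
This is O'Neill's formula `(DA)(X, Y, V) = V(A(X,Y)) - A(D_V X, Y) - A(X, D_V Y)` for the covariant
differential (Ch. 3, Def. 3.16–3.17) of a `(0,2)` tensor, obtained from the product rule for the
tensor derivation `D_V` (Ch. 2, Prop. 2.13, Thm. 2.15), evaluated pointwise (Ch. 2, Prop. 2.2):
`covDeriv₂_apply_extend` and `covDeriv₂Aux_apply_eq_extend`. (The hypothesis that `Z` be
differentiable is not needed.)
[cite: ONeillSemiRiemannian1983, Ch. 2, Thm. 2.15 (p. 48) and Ch. 3, Def. 3.16–3.17] -/
theorem covDeriv₂_apply_holds : g.covDeriv₂_apply := by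
  intro _ _ _ _ x k hk X Y Z hX hY _
  rw [covDeriv₂_apply_extend hk, ← covDeriv₂Aux_apply_eq_extend hk hX hY Z]

end PseudoRiemannianMetric

end Literature.Geometry.Lorentzian

end
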